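import Summits.BirchSwinnertonDyer.BirchSwinnertonDyer.Theorems.AlignedTransportAtTwoMainConjectureOfRankZeroBSDAtTwoTwistSaturationLValue
import Summits.BirchSwinnertonDyer.BirchSwinnertonDyer.Theorems.AlignedTransportAtTwoMainConjectureOfRankZeroBSDAtTwoSelmerLayerLambdaBound
import Summits.BirchSwinnertonDyer.BirchSwinnertonDyer.Theorems.AlignedTransportAtTwoMainConjectureOfRankZeroBSDAtTwoCyclotomicLayerRankDichotomy
import Summits.BirchSwinnertonDyer.BirchSwinnertonDyer.Theorems.ByReductionTypeAtTwoMultTransportRankCert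
import Literature.NumberTheory.EllipticCurves.Greenberg1999.MordellWeilRankLayerBoundProofs
import HarnessLib

/-!
# Route `AlignedTransportAtTwo`, crux C2 `MainConjectureOfRankZeroBSDAtTwo` (stmt-BirchSwinnertonDyer-22298):
# THE TOWER PROFILE OF A TWIST-SATURATED SEED — `rank W(ℚ_n) = rank W⁽²⁾(ℚ)` EXACTLY and `corank Ш(W/ℚ_n)[2^∞] = 0` at EVERY layer `n ≥ 1`
# of the cyclotomic `ℤ₂`-tower, and `rank W(ℚ) = 0`: the whole Mordell–Weil growth happens at `ℚ_1 = ℚ(√2)` and is carried by the twist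

HONEST FRAMING (cell `bsd-f1-sign2`, WIDTH-5 attached prover seat `bsd-line-att-p5` gen 46 on line `birth` of the lead `bsd-line-att-p2`;
`--supports` stmt-BirchSwinnertonDyer-22298, closes nothing; BSD is NOT proved by any of this; the crux C2, its verdict «blocked-on
`Rank1Residual.GreenbergMuConjectureIrreducible`» and every registered stub are untouched). THEOREMS ONLY — no `def`, no instance, no named fact, no `sorry`.

Sequel of `…TwistSaturation` (p811907) and `…TwistSaturationLValue` (p812157). There: saturation `v + 2e + s ≤ rank W₂(ℚ) + 2t` forces
`μ(X(W/ℚ_∞)) = 0`, `λ(X(W/ℚ_∞)) = rank W₂(ℚ)`, `char X = ((T+2)^{rank W₂(ℚ)})`. Here the two printed halves of Greenberg's Theorem 1.9, both TREE THEOREMS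
(`WeierstrassCurve.mordellWeilRank_layer_le_lambdaInvariant`, Literature; `…SelmerLayerLambdaBound.selmerCorank_layer_le_lambdaInvariant`, g41), the
first-layer identity `rank W(ℚ_1) = rank W(ℚ) + rank W⁽²⁾(ℚ)` (`√2 ∈ ℚ_1`, AEC Ex. 10.16; bsd-2adic `MultRankCert.mordellWeilRank_baseChange_eq_add_of_sq_eq`)
and monotonicity up the tower (g36 `mordellWeilRank_layer_mono`) pin the WHOLE tower:

* ★★★ `towerProfile_of_le_mordellWeilRank_twist` (datum level, UNCONDITIONAL): under the hypotheses of p811907's door, for every `n ≥ 1`: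
  **`rank W(ℚ_n) = rank W₂(ℚ)`, `corank_{ℤ₂} Sel_{2^∞}(W/ℚ_n) = rank W₂(ℚ)`, `corank_{ℤ₂} Ш(W/ℚ_n)[2^∞] = 0`**, and `rank W(ℚ) = 0`.
* ★★ `towerProfile_of_bsdp_of_lValue_of_le_mordellWeilRank_twist` (cell currency: GZK + `BSD(W,2)` + `r_an = 0` + `∏c` odd + `L`-value bit + `2·ord₂#Ẽ(𝔽₂) ≤ rank W₂`):
  the same profile — for the rows `N = 503, 417, 2703, …` of this gen: **`rank W(ℚ(ζ_{2^{n+2}})⁺) = 2` and `Ш(W/ℚ(ζ_{2^{n+2}})⁺)[2^∞]` cofinite-free (corank `0`)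
  for EVERY `n ≥ 1`**, modulo the row's displayed binders.

HONEST SCOPE. Corank `0` of `Ш[2^∞]` is finiteness of `Ш[2^∞]` for the cofinitely generated group; the file records the corank statement the tree's
`shaCorank` currency gives. Nothing here is a statement about curves whose twist is not saturated. BSD is not proved by any of this.

References: R. Greenberg, LNM 1716 (1999), Thm. 1.9 (p. 63), Thm. 4.1 (p. 102), §4 p. 107 [GreenbergLNM1716]; J. H. Silverman, AEC (2009) Ex. 10.16, VIII.6.7
[SilvermanAEC2009]; L. Washington, GTM 83, §13.1 [Washington1997].
-/

set_option linter.dupNamespace false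
set_option autoImplicit false

noncomputable section

open scoped Classical

namespace Summit.BirchSwinnertonDyer.BirchSwinnertonDyer.Theorems.AlignedTransportAtTwoTwistSaturation

open PowerSeries WeierstrassCurve Literature.NumberTheory.EllipticCurves
  Literature.NumberTheory.EllipticCurves.Rank1Residual
  Literature.NumberTheory.EllipticCurves.Greenberg1999
  Literature.NumberTheory.EllipticCurves.Module
  Literature.NumberTheory.EllipticCurves.IwasawaAlgebra
  Summit.BirchSwinnertonDyer.Rank1Residual
  Summit.BirchSwinnertonDyer.Rank1Residual.X1.MuLambda
  Summit.BirchSwinnertonDyer.Rank1Residual.X5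
  Summit.BirchSwinnertonDyer.Rank1Residual.Iwasawa
  Summit.BirchSwinnertonDyer.BirchSwinnertonDyer.Theorems.Rank1ResidualX1Defs
  Summit.BirchSwinnertonDyer.BirchSwinnertonDyer.Theorems.AlignedTransportAtTwoSelmerLayerLambdaBound
  Summit.BirchSwinnertonDyer.BirchSwinnertonDyer.Theorems.AlignedTransportAtTwoCyclotomicLayerRankDichotomy
  Summit.BirchSwinnertonDyer.BirchSwinnertonDyer.Theorems.MultRankCert

section Datum

variable (κ : ZpExtension ℚ 2) (hκ : κ.IsCyclotomic) {γ : Field.absoluteGaloisGroup ℚ} (hγ : κ.IsTopGenerator γ)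
  (hγ' : IsCyclotomicVariable 2 γ)
  (W W₂ : WeierstrassCurve ℚ) [W.IsElliptic] [W.IsGloballyMinimal] [W₂.IsElliptic] {V : VariableChange ℚ}
  (hV : V • W₂ = W.quadraticTwist 2)

include hκ hV in
omit [W.IsGloballyMinimal] [W₂.IsElliptic] in
/-- **`rank W⁽²⁾(ℚ) ≤ rank W(ℚ) + rank W⁽²⁾(ℚ) = rank W(ℚ_1) ≤ rank W(ℚ_n)` for `n ≥ 1`** (`√2 ∈ ℚ_1`, AEC Ex. 10.16, rank invariant under `V`; monotonicity up the tower).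
[cite: SilvermanAEC2009, Exercise 10.16 and III.3.1(b)] [cite: Washington1997, §13.1] -/
theorem mordellWeilRank_add_twist_le_layer {n : ℕ} (hn : 1 ≤ n) :
    W.mordellWeilRank + W₂.mordellWeilRank ≤ (W.baseChange (κ.layer n)).mordellWeilRank := by
  have h2 : Module.finrank ℚ (κ.layer 1) = 2 := by rw [κ.finrank_layer_holds 1, pow_one]
  obtain ⟨θ, hθ2⟩ := hκ.exists_sq_eq_two_layer_one
  have hc : θ ^ 2 = algebraMap ℚ (κ.layer 1) 2 := by rw [hθ2, map_ofNat]
  have hθ : θ ∉ Set.range (algebraMap ℚ (κ.layer 1)) := by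
    rintro ⟨r, rfl⟩
    apply AddSelmerTwistTwo.not_exists_rat_sq_eq_two
    refine ⟨r, ?_⟩
    have e : algebraMap ℚ (κ.layer 1) (r ^ 2) = algebraMap ℚ (κ.layer 1) 2 := by rw [map_pow, hc]
    exact (algebraMap ℚ (κ.layer 1)).injective e
  have e1 := mordellWeilRank_baseChange_eq_add_of_sq_eq W (κ.layer 1) h2 hθ hc
  have eV : (V • W₂).mordellWeilRank = W₂.mordellWeilRank := mordellWeilRank_variableChange_holds W₂ V
  rw [hV] at eV
  have hmono := mordellWeilRank_layer_mono W κ hn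
  have h1 : W.mordellWeilRank + W₂.mordellWeilRank ≤ (W.baseChange (κ.layer 1)).mordellWeilRank := by
    rw [← eV]; convert e1.symm.le using 2
  exact h1.trans hmono

include hκ hγ hγ' hV in
/-- ★★★ **THE TOWER PROFILE OF A TWIST-SATURATED SEED — UNCONDITIONAL.** `W/ℚ` globally minimal, good ordinary at `2`, `Sel_{2^∞}(W/ℚ)` finite,
`W₂` any `ℚ`-model of `W⁽²⁾`, `(κ, γ)` the normalised cyclotomic datum, `D` any dual datum, `#W(ℚ)[2^∞] = 2^t`, `#Ẽ(𝔽₂)[2^∞] = 2^e`, `#Sel_{2^∞}(W/ℚ) = 2^s`,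
`v = ord₂∏c_ℓ`, and SATURATION `v + 2e + s ≤ rank W₂(ℚ) + 2t`. Then for every layer `n ≥ 1` of the cyclotomic `ℤ₂`-tower:
**`rank W(ℚ_n) = rank W₂(ℚ)`, `corank_{ℤ₂} Sel_{2^∞}(W/ℚ_n) = rank W₂(ℚ)`, `corank_{ℤ₂} Ш(W/ℚ_n)[2^∞] = 0`**, and `rank W(ℚ) = 0` — all the Mordell–Weil
growth of the tower happens at `ℚ_1 = ℚ(√2)` and is the twist's (`λ = rank W₂(ℚ)` by p811907; Greenberg's Thm. 1.9 in both printed halves, tree theorems;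
`rank W(ℚ_1) = rank W + rank W⁽²⁾`; monotonicity). [cite: GreenbergLNM1716, Thm. 1.9 (p. 63), Thm. 4.1 (p. 102), §4 p. 107] [cite: SilvermanAEC2009, Exercise 10.16] -/
theorem towerProfile_of_le_mordellWeilRank_twist (hord : IsOrdinaryAt W 2) (D : W.SelmerDualData κ γ)
    (hfin : Finite (W.selmerGroupPInfty 2)) {t e s : ℕ}
    (ht : Nat.card (AddCommGroup.primaryComponent W.toAffine.Point 2) = 2 ^ t)
    (he : Nat.card (AddCommGroup.primaryComponent ((integralModelInt W).map (Int.castRingHom (ZMod 2))).toAffine.Point 2) = 2 ^ e)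
    (hs : Nat.card (W.selmerGroupPInfty 2) = 2 ^ s)
    (hsat : padicValNat 2 W.tamagawaProduct + 2 * e + s ≤ W₂.mordellWeilRank + 2 * t) {n : ℕ} (hn : 1 ≤ n) :
    (W.baseChange (κ.layer n)).mordellWeilRank = W₂.mordellWeilRank ∧
      (W.baseChange (κ.layer n)).selmerCorank 2 = W₂.mordellWeilRank ∧
      (W.baseChange (κ.layer n)).shaCorank 2 = 0 ∧ W.mordellWeilRank = 0 := by
  haveI : Module.Finite (IwasawaAlgebra 2) D.X := D.module_finite_holds hγ
  have hD : D.IsTorsion := isTorsion_of_finite κ hκ hγ W hord D hfin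
  obtain ⟨-, hlam', -⟩ := mu_eq_zero_of_le_mordellWeilRank_twist κ hκ hγ hγ' W W₂ hV hord D hfin ht he hs hsat
  have hlam : lambdaInvariant 2 D.X = W₂.mordellWeilRank := hlam'
  have hup : (W.baseChange (κ.layer n)).mordellWeilRank ≤ W₂.mordellWeilRank := by
    rw [← hlam]; exact W.mordellWeilRank_layer_le_lambdaInvariant hγ D hD n
  have hupS : (W.baseChange (κ.layer n)).selmerCorank 2 ≤ W₂.mordellWeilRank := by
    rw [← hlam]; exact selmerCorank_layer_le_lambdaInvariant W hγ D hD n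
  have hlow := mordellWeilRank_add_twist_le_layer κ hκ W W₂ hV hn
  have hrk : (W.baseChange (κ.layer n)).mordellWeilRank = W₂.mordellWeilRank := by omega
  have hsha : (W.baseChange (κ.layer n)).shaCorank 2 = 0 :=
    shaCorank_layer_eq_zero_of_lambdaInvariant_le_mordellWeilRank W hγ D hD n (by rw [hlam]; exact le_of_eq hrk.symm)
  haveI : (W.baseChange (κ.layer n)).IsElliptic := by rw [baseChange]; infer_instance
  have hsel : (W.baseChange (κ.layer n)).selmerCorank 2 = W₂.mordellWeilRank := by
    have h := (W.baseChange (κ.layer n)).selmerCorank_eq_mordellWeilRank_add_holds 2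
    rw [hrk, hsha, add_zero] at h
    exact h
  exact ⟨hrk, hsel, hsha, by omega⟩

end Datum

section Cell

variable (W W₂ : WeierstrassCurve ℚ) [W.IsElliptic] [W.IsGloballyMinimal] [W₂.IsElliptic] {V : VariableChange ℚ}
  (hV : V • W₂ = W.quadraticTwist 2)

include hV in
/-- ★★ **THE TOWER PROFILE IN THE CELL'S CURRENCY.** `W` globally minimal, good ordinary at `2`, no rational point of order `2`, `r_an(W) = 0`, `BSD(W,2)`,
`∏c_ℓ` odd, `L(W,1)/Ω_W = q` (`q ≠ 0`, `ord₂ q = 0`), GZK; `W₂` a `ℚ`-model of `W⁽²⁾` with `2·ord₂ #Ẽ(𝔽₂) ≤ rank W₂(ℚ)`. Then for EVERY cyclotomic `ℤ₂`-extension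
datum `(κ, γ)` (normalised generator) and every layer `n ≥ 1`: **`rank W(ℚ_n) = rank W₂(ℚ)`, `corank Sel_{2^∞}(W/ℚ_n) = rank W₂(ℚ)`, `corank Ш(W/ℚ_n)[2^∞] = 0`**. On the rows of this gen
(`a₂ = +1`, two points on the twist): the rank is `0` over `ℚ` and `2` at every layer `ℚ(ζ_{2^{n+2}})⁺`, `n ≥ 1`. [cite: GreenbergLNM1716, Thm. 1.9 (p. 63), Thm. 4.1 (p. 102)]
[cite: Miller2011LMS, Def. 1.1] [cite: SilvermanAEC2009, Exercise 10.16] -/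
theorem towerProfile_of_bsdp_of_lValue_of_le_mordellWeilRank_twist (hGZK : rank_eq_analyticRank_of_analyticRank_le_one)
    (hord : IsOrdinaryAt W 2) (ht : ∀ x : ℚ, ¬ HasRationalTwoTorsionX W x) (hr : W.analyticRank = 0) (hbsd : BSDp W 2)
    (htam : Odd W.tamagawaProduct)
    (hL : ∃ q : ℚ, q ≠ 0 ∧ W.entireLFunction 1 / (W.realPeriodRat : ℂ) = (q : ℂ) ∧ padicValRat 2 q = 0)
    (hsat : 2 * padicValNat 2 (W.reductionPointCount 2) ≤ W₂.mordellWeilRank)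
    (κ : ZpExtension ℚ 2) (hκ : κ.IsCyclotomic) {γ : Field.absoluteGaloisGroup ℚ} (hγ : κ.IsTopGenerator γ)
    (hγ' : IsCyclotomicVariable 2 γ) {n : ℕ} (hn : 1 ≤ n) :
    (W.baseChange (κ.layer n)).mordellWeilRank = W₂.mordellWeilRank ∧
      (W.baseChange (κ.layer n)).selmerCorank 2 = W₂.mordellWeilRank ∧
      (W.baseChange (κ.layer n)).shaCorank 2 = 0 := by
  obtain ⟨D⟩ := W.nonempty_selmerDualData_holds κ γ hγ
  have hfin : Finite (W.selmerGroupPInfty 2) := finite_selmerGroupPInfty_two_of_analyticRank_eq_zero W hGZK hr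
  have ht0 : Nat.card (AddCommGroup.primaryComponent W.toAffine.Point 2) = 2 ^ 0 := by
    rw [pow_zero]; exact natCard_primaryComponent_point_two_eq_one W ht
  have he := InputsGreenbergCharValue.natCard_primaryComponent_reduction_eq_pow W 2
  have hs : Nat.card (W.selmerGroupPInfty 2) = 2 ^ 0 := by
    rw [pow_zero]; exact natCard_selmerGroupPInfty_two_eq_one_of_bsdp_of_lValue W ht hr hbsd htam hL
  have hv : padicValNat 2 W.tamagawaProduct = 0 :=
    padicValNat.eq_zero_of_not_dvd (AlignedTransportAtTwoSelmerTwoOfBSDp.not_two_dvd_tamagawaProduct_of_odd W htam)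
  obtain ⟨h1, h2, h3, -⟩ := towerProfile_of_le_mordellWeilRank_twist κ hκ hγ hγ' W W₂ hV hord D hfin ht0 he hs (by rw [hv]; omega) hn
  exact ⟨h1, h2, h3⟩

end Cell

end Summit.BirchSwinnertonDyer.BirchSwinnertonDyer.Theorems.AlignedTransportAtTwoTwistSaturation

end
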